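import Literature.Analysis.FluidPDE.OseenKernelLineIntegrals
import Literature.Analysis.FluidPDE.OseenDuhamelPairCalculus
import HarnessLib

/-!
# A lower bound for the Oseen slice constant: `C₀(ℝ³) ≥ (4π)^{-1/2}` (the shear layer)

Analysis/FluidPDE proof file (theorems only; no definitions, no named facts, no `sorry`). The
tree's slice constant `C₀ = oseenSliceConst ℝ³` (`OseenDuhamelPairCalculus.lean`) is a
`Classical.choose` of KNSS 2009 (3.5): «`∃ C₀ > 0`, for all bounded fields `a, b`, all `σ > 0` and
all `x`, `‖N_σ[a, b](x)‖ ≤ C₀ σ^{-1/2} sup‖a‖ sup‖b‖`», `N_σ[a,b](x) = ∫ K(σ, x − y)[a(y), b(y)] dy`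
the kernel realisation of `e^{σΔ}P∇·(a ⊗ b)` (`oseenSlice`). Nothing bounds the chosen value from
ABOVE, but every explicit pair bounds it from BELOW. This file evaluates the slice of the SHEAR
LAYER `a = 𝟙{y₀ > 0} e₀`, `b ≡ e₁` at the origin, tested against `e₁`:

  `⟪N_σ[𝟙{y₀>0} e₀, e₁](0), e₁⟫ = (4πσ)^{-1/2}`

(the distributional divergence of `a ⊗ b` is the divergence-free measure `δ(y₀) e₁`, so `P` is the
identity and `e^{σΔ}` smears it to the one-dimensional heat kernel), whence

* `inv_sqrt_four_pi_le_oseenSliceConst` — **`(4π)^{-1/2} ≤ oseenSliceConst ℝ³`**, and the decimal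
  form `oseenSliceConst_gt : 0.282 < oseenSliceConst ℝ³`.

The computation is done on the CLOSED kernel (Koch–Tataru 2001, (8):
`K(σ,z)[a,b] = −(⟪z,a⟫/2σ)G_σ(z) b + A(⟪z,a⟫b + ⟪a,b⟫z + ⟪z,b⟫a) − B⟪z,a⟫⟪z,b⟫z`) with the tree's
line-integral calculus (`OseenKernelLineIntegrals.lean`, KNSS 2009 Thm 6.2's «independent of `x₂`»
step): on every line parallel to `e₁` the `e₁`-component of `K(σ, z' + ρe₁)[e₀, e₁]` is
`−(⟪z',e₀⟫/2σ) G_σ + ⟪z',e₀⟫ (A − ρ²B)` (`inner_oseenKernel_line_self`), the Gaussian-moment identity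
`∫ (A − ρ²B) dρ = 0` kills the Leray part (`integral_inner_oseenKernel_line_self`), the mass of the
heat kernel along the line is `(4πσ)^{-3/2} e^{-‖z'‖²/4σ} √(4πσ)`, and the remaining planar integral
`∫_{w₀>0} (w₀/2σ)(4πσ)^{-1} e^{-‖w‖²/4σ} dw` factorises into `∫₀^∞ u e^{-u²/4σ} du = 2σ` and
`∫ e^{-v²/4σ} dv = √(4πσ)`.

Consumer: the cell `ns-blowup` (route `PalasekTowerBreakdown`, crux `EpisodeBase`,
stmt-NavierStokesRegularity-19179): the PRICE of the shadowed-run (certificate) door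
(`Germ.defect_le_of_door_hypothesis`, p511595) is `D + F ≤ ¼ exp(−36·5508·C₀²)`; with this file it is
an unconditional number, `≤ ¼ e^{−15700}` (refuter4 g8, K167 (R1): «worth ONE Literature fact
`oseenSliceConst_ge`»). LABEL: Literature port (explicit evaluation of a tree object). WHAT THIS IS
NOT: not a statement about Navier–Stokes dynamics.

## Mathlib / tree search

Tree: `oseenKernel`, `oseenKernel_smul_left`, `oseenSlice_apply`, `norm_oseenSlice_le_oseenSliceConst`,
`integral_heatKernel_line`, `integrable_heatKernel_line`, `integral_oseenWeightA_line`,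
`integral_sq_mul_oseenWeightB_line`, `integral_oseenWeightA_sub_sq_mul_oseenWeightB_line`,
`integral_eq_integral_integral_line`, `toLp_line_eq`, `inner_toLp_base_single`, `norm_single_one_one`,
`integrable_oseenKernel_sub_of_bounded` (`OseenKernelLineIntegrals`). Mathlib: `integral_gaussian`,
`integrable_mul_exp_neg_mul_sq`, `integrable_exp_neg_mul_sq`, `integral_Ioi_of_hasDerivAt_of_tendsto'`,
`integral_prod_mul`, `volume_preserving_finTwoArrow`,
`EuclideanSpace.volume_preserving_symm_measurableEquiv_toLp`, `real_inner_le_norm`. No lower bound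
for `oseenSliceConst` existed (`lean search 'oseenSliceConst_ge|le_oseenSliceConst'`).

## References

* H. Koch, D. Tataru, Adv. Math. 157 (2001), §2 (8). [cite: KochTataruAdvMath2001, §2 (8)]
* G. Koch, N. Nadirashvili, G. Seregin, V. Šverák, Acta Math. 203 (2009), §3 (3.5).
  [cite: KochNadirashviliSereginSverak2009, §3 (3.5) and §4 p. 8 (arXiv:0709.3599v1)]
-/

noncomputable section

open MeasureTheory Set Function Filter Real WithLp
open scoped RealInnerProductSpace Topology

namespace Literature.Analysis.FluidPDE

/-! ## §1 Two one-dimensional Gaussian integrals and a planar product integral -/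

section Gaussian

/-- `∫_0^∞ w e^{-bw²} dw = 1/(2b)` for `b > 0` (FTC with the primitive `−e^{−bw²}/(2b)`). [folklore] -/
private theorem integral_mul_exp_neg_mul_sq_Ioi_zero {b : ℝ} (hb : 0 < b) :
    ∫ w in Ioi (0 : ℝ), w * Real.exp (-b * w ^ 2) = 1 / (2 * b) := by
  have hderiv : ∀ w ∈ Ici (0 : ℝ),
      HasDerivAt (fun w : ℝ => -Real.exp (-b * w ^ 2) / (2 * b)) (w * Real.exp (-b * w ^ 2)) w := by
    intro w _
    have e1 : HasDerivAt (fun w : ℝ => -b * w ^ 2) (-b * (2 * w)) w := by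
      simpa using (hasDerivAt_pow 2 w).const_mul (-b)
    have e3 := (e1.exp.neg).div_const (2 * b)
    refine e3.congr_deriv ?_
    rw [div_eq_iff (by positivity)]
    ring
  have hint : IntegrableOn (fun w : ℝ => w * Real.exp (-b * w ^ 2)) (Ioi 0) :=
    (integrable_mul_exp_neg_mul_sq hb).integrableOn
  have htend : Tendsto (fun w : ℝ => -Real.exp (-b * w ^ 2) / (2 * b)) atTop (𝓝 (-0 / (2 * b))) := by
    refine (Tendsto.neg ?_).div_const _
    have : Tendsto (fun w : ℝ => -b * w ^ 2) atTop atBot :=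
      (tendsto_pow_atTop (α := ℝ) two_ne_zero).const_mul_atTop_of_neg (neg_lt_zero.2 hb)
    exact Real.tendsto_exp_atBot.comp this
  rw [integral_Ioi_of_hasDerivAt_of_tendsto' hderiv hint htend]
  have h0 : Real.exp (-b * (0 : ℝ) ^ 2) = 1 := by simp
  rw [h0]
  ring

/-- `∫ 𝟙_{(0,∞)}(w) w e^{-bw²} dw = 1/(2b)` on the whole line. [folklore] -/
private theorem integral_indicator_mul_exp_neg_mul_sq {b : ℝ} (hb : 0 < b) :
    ∫ w : ℝ, (Ioi (0 : ℝ)).indicator (fun w => w * Real.exp (-b * w ^ 2)) w = 1 / (2 * b) := by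
  rw [integral_indicator measurableSet_Ioi, integral_mul_exp_neg_mul_sq_Ioi_zero hb]

/-- **Product integrals on the Euclidean plane**: `∫_{ℝ²} F(w₀) G(w₁) dw = (∫ F)(∫ G)` (the
volume-preserving identification `EuclideanSpace ℝ (Fin 2) ≃ ℝ × ℝ`, `w ↦ (w₀, w₁)`). [folklore] -/
private theorem integral_euclidean_two_mul (F G : ℝ → ℝ) :
    ∫ w : EuclideanSpace ℝ (Fin 2), F (w 0) * G (w 1) = (∫ u, F u) * ∫ v, G v := by
  set Ψ : EuclideanSpace ℝ (Fin 2) ≃ᵐ ℝ × ℝ :=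
    (MeasurableEquiv.toLp 2 (Fin 2 → ℝ)).symm.trans (MeasurableEquiv.finTwoArrow (α := ℝ)) with hΨ
  have hmp : MeasurePreserving Ψ volume volume :=
    (EuclideanSpace.volume_preserving_symm_measurableEquiv_toLp (Fin 2)).trans
      (volume_preserving_finTwoArrow ℝ)
  have h1 := hmp.integral_comp Ψ.measurableEmbedding (fun p : ℝ × ℝ => F p.1 * G p.2)
  have h2 : (fun w : EuclideanSpace ℝ (Fin 2) => (fun p : ℝ × ℝ => F p.1 * G p.2) (Ψ w)) =
      fun w => F (w 0) * G (w 1) := by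
    funext w; rfl
  rw [h2] at h1
  rw [h1]
  exact integral_prod_mul F G

end Gaussian

/-! ## §2 The kernel along a line, both free slots along the line -/

section Line

variable {E : Type*} [NormedAddCommGroup E] [InnerProductSpace ℝ E] {e z' a : E}

/-- **The `e`-component of `K(σ, z' + ρe)[a, e]` for `a ⊥ e`, `z' ⊥ e`, `‖e‖ = 1`**:
`⟪K(σ, z' + ρe)[a, e], e⟫ = −(⟪z',a⟫/2σ) G_σ(z' + ρe) + ⟪z',a⟫ (A − ρ²B)(σ, z' + ρe)` (Koch–Tataru
2001, (8): `⟪z'+ρe, a⟫ = ⟪z', a⟫`, `⟪a, e⟫ = 0`, `⟪z'+ρe, e⟫ = ρ`). [cite: KochTataruAdvMath2001, §2 (8)] -/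
theorem inner_oseenKernel_line_self (he : ‖e‖ = 1) (hz : ⟪z', e⟫ = 0) (ha : ⟪a, e⟫ = 0) (σ ρ : ℝ) :
    ⟪oseenKernel σ (z' + ρ • e) a e, e⟫ =
      -(⟪z', a⟫ / (2 * σ)) * UnboundedOperators.heatKernel σ (z' + ρ • e) +
        ⟪z', a⟫ * (oseenWeightA σ (z' + ρ • e) - ρ ^ 2 * oseenWeightB σ (z' + ρ • e)) := by
  have hee : ⟪e, e⟫ = 1 := by rw [real_inner_self_eq_norm_sq, he, one_pow]
  have hea : ⟪e, a⟫ = 0 := by rw [real_inner_comm]; exact ha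
  simp only [oseenKernel, inner_add_left, inner_sub_left, real_inner_smul_left, hz, ha, hee, hea]
  ring

/-- **Integrated along the line, only the heat-kernel part survives**:
`∫ ⟪K(σ, z' + ρe)[a, e], e⟫ dρ = −(⟪z',a⟫/2σ) (4πσ)^{−d/2} e^{−‖z'‖²/4σ} √(4πσ)` for `a ⊥ e`, `z' ⊥ e`,
`‖e‖ = 1`, `σ > 0` — the Leray part is killed by the Gaussian-moment identity `∫ (A − ρ²B) dρ = 0`.
[cite: KochTataruAdvMath2001, §2 (8)] -/
theorem integral_inner_oseenKernel_line_self (he : ‖e‖ = 1) (hz : ⟪z', e⟫ = 0) (ha : ⟪a, e⟫ = 0)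
    {σ : ℝ} (hσ : 0 < σ) :
    ∫ ρ : ℝ, ⟪oseenKernel σ (z' + ρ • e) a e, e⟫ =
      -(⟪z', a⟫ / (2 * σ)) * ((4 * π * σ) ^ (-(Module.finrank ℝ E : ℝ) / 2) *
        Real.exp (-‖z'‖ ^ 2 / (4 * σ)) * √(4 * π * σ)) := by
  obtain ⟨hA, -⟩ := integral_oseenWeightA_line he hz hσ
  obtain ⟨hB, -⟩ := integral_sq_mul_oseenWeightB_line he hz hσ
  have hG := integrable_heatKernel_line he hz hσ
  have hAB : Integrable (fun ρ : ℝ =>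
      oseenWeightA σ (z' + ρ • e) - ρ ^ 2 * oseenWeightB σ (z' + ρ • e)) := hA.sub hB
  simp_rw [inner_oseenKernel_line_self he hz ha]
  rw [integral_add (hG.const_mul _) (hAB.const_mul _), integral_const_mul, integral_const_mul,
    integral_heatKernel_line he hz hσ, integral_oseenWeightA_sub_sq_mul_oseenWeightB_line he hz hσ,
    mul_zero, add_zero]

end Line

/-! ## §3 The shear layer in `ℝ³` -/

section R3

/-- `⟪e₀, e₁⟫ = 0`. [folklore] -/
private theorem inner_single_zero_single_one :
    ⟪(EuclideanSpace.single (0 : Fin 3) (1 : ℝ) : EuclideanSpace ℝ (Fin 3)),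
      EuclideanSpace.single (1 : Fin 3) (1 : ℝ)⟫ = 0 := by
  rw [EuclideanSpace.inner_single_left]
  simp

/-- The base point `(w₀, 0, w₁)` has `e₀`-coordinate `w₀`. [folklore] -/
private theorem inner_toLp_base_single_zero (w : EuclideanSpace ℝ (Fin 2)) :
    ⟪(toLp 2 ![w 0, 0, w 1] : EuclideanSpace ℝ (Fin 3)), EuclideanSpace.single (0 : Fin 3) (1 : ℝ)⟫ =
      w 0 := by
  rw [EuclideanSpace.inner_single_right]
  simp

/-- The base point `(w₀, 0, w₁)` has the norm of `w`. [folklore] -/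
private theorem norm_toLp_base_sq (w : EuclideanSpace ℝ (Fin 2)) :
    ‖(toLp 2 ![w 0, 0, w 1] : EuclideanSpace ℝ (Fin 3))‖ ^ 2 = w 0 ^ 2 + w 1 ^ 2 := by
  rw [EuclideanSpace.norm_sq_eq, Fin.sum_univ_three]
  simp [Real.norm_eq_abs, sq_abs]

/-- **THE SHEAR LAYER.** The Oseen slice at unit time of the pair `a = 𝟙{y₀ > 0} e₀`, `b ≡ e₁`
at the origin, tested against `e₁`, equals `(4π)^{-1/2}`:
`⟪N₁[𝟙{y₀>0} e₀, e₁](0), e₁⟫ = (√(4π))⁻¹`. [cite: KochTataruAdvMath2001, §2 (8)] -/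
theorem inner_oseenSlice_shearLayer_one :
    ⟪oseenSlice 1
        (fun y : EuclideanSpace ℝ (Fin 3) =>
          ({y : EuclideanSpace ℝ (Fin 3) | 0 < y 0}.indicator (fun _ => (1 : ℝ)) y) •
            EuclideanSpace.single (0 : Fin 3) (1 : ℝ))
        (fun _ => EuclideanSpace.single (1 : Fin 3) (1 : ℝ)) 0,
      EuclideanSpace.single (1 : Fin 3) (1 : ℝ)⟫ = (√(4 * π))⁻¹ := by
  -- ### notation
  set e0 : EuclideanSpace ℝ (Fin 3) := EuclideanSpace.single (0 : Fin 3) (1 : ℝ) with he0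
  set e1 : EuclideanSpace ℝ (Fin 3) := EuclideanSpace.single (1 : Fin 3) (1 : ℝ) with he1
  set S : Set (EuclideanSpace ℝ (Fin 3)) := {y | 0 < y 0} with hS
  set h : EuclideanSpace ℝ (Fin 3) → ℝ := S.indicator (fun _ => (1 : ℝ)) with hh
  have he1n : ‖e1‖ = 1 := norm_single_one_one
  have hpi : 0 < 4 * π := by positivity
  -- measurability and bounds of the pair
  have hSm : MeasurableSet S :=
    measurableSet_lt measurable_const (EuclideanSpace.proj (0 : Fin 3)).continuous.measurable
  have hhm : Measurable h := measurable_const.indicator hSm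
  have hh_le : ∀ y, |h y| ≤ 1 := by
    intro y
    rw [hh, Set.indicator_apply]
    split_ifs <;> simp
  have ham : AEStronglyMeasurable (fun y => h y • e0) volume := (hhm.smul_const e0).aestronglyMeasurable
  have hbm : AEStronglyMeasurable (fun _ : EuclideanSpace ℝ (Fin 3) => e1) volume :=
    aestronglyMeasurable_const
  have ha1 : ∀ y, ‖h y • e0‖ ≤ 1 := fun y => by
    rw [norm_smul, he0, Real.norm_eq_abs]
    have : ‖(EuclideanSpace.single (0 : Fin 3) (1 : ℝ) : EuclideanSpace ℝ (Fin 3))‖ = 1 := by simp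
    rw [this, mul_one]; exact hh_le y
  have hb1 : ∀ y : EuclideanSpace ℝ (Fin 3), ‖(fun _ : EuclideanSpace ℝ (Fin 3) => e1) y‖ ≤ 1 :=
    fun y => by simp only [he1n, le_refl]
  -- ### Step 1: pull the scalar profile out of the divergence slot
  have hint : Integrable fun y : EuclideanSpace ℝ (Fin 3) => oseenKernel 1 (0 - y) (h y • e0) e1 :=
    integrable_oseenKernel_sub_of_bounded one_pos ham hbm ha1 hb1 0
  rw [oseenSlice_apply, real_inner_comm, ← integral_inner hint e1]
  have hpt : ∀ y : EuclideanSpace ℝ (Fin 3),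
      ⟪e1, oseenKernel 1 (0 - y) (h y • e0) e1⟫ = h y * ⟪oseenKernel 1 (0 - y) e0 e1, e1⟫ := by
    intro y
    rw [oseenKernel_smul_left, real_inner_smul_right, real_inner_comm]
  simp_rw [hpt]
  -- ### Step 2: Fubini along the lines parallel to `e₁`
  have hG : Integrable fun y : EuclideanSpace ℝ (Fin 3) => h y * ⟪oseenKernel 1 (0 - y) e0 e1, e1⟫ := by
    have := hint.const_inner (𝕜 := ℝ) e1
    refine this.congr (Eventually.of_forall fun y => ?_)
    exact hpt y
  rw [integral_eq_integral_integral_line hG]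
  -- ### Step 3: the line integrals
  have hline : ∀ w : EuclideanSpace ℝ (Fin 2),
      (∫ r : ℝ, h (toLp 2 ![w 0, r, w 1]) * ⟪oseenKernel 1 (0 - toLp 2 ![w 0, r, w 1]) e0 e1, e1⟫) =
        (Ioi (0 : ℝ)).indicator (fun u => u * Real.exp (-(1 / 4) * u ^ 2)) (w 0) *
          ((4 * π) ^ (-(3 : ℝ) / 2) * √(4 * π) / 2 * Real.exp (-(1 / 4) * w 1 ^ 2)) := by
    intro w
    -- the base point of the line and its geometry
    set p₀ : EuclideanSpace ℝ (Fin 3) := toLp 2 ![w 0, 0, w 1] with hp₀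
    have hz : ⟪-p₀, e1⟫ = 0 := by rw [inner_neg_left, hp₀, inner_toLp_base_single, neg_zero]
    have hza : ⟪-p₀, e0⟫ = -w 0 := by rw [inner_neg_left, hp₀, inner_toLp_base_single_zero]
    have hzn : ‖-p₀‖ ^ 2 = w 0 ^ 2 + w 1 ^ 2 := by rw [norm_neg, hp₀, norm_toLp_base_sq]
    have hae : ⟪e0, e1⟫ = 0 := inner_single_zero_single_one
    -- the profile is constant along the line
    have hprof : ∀ r : ℝ, h (toLp 2 ![w 0, r, w 1]) = (Ioi (0 : ℝ)).indicator (fun _ => (1 : ℝ)) (w 0) := by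
      intro r
      simp [hh, hS, Set.indicator_apply, Set.mem_Ioi]
    -- the translate along the line
    have hsub : ∀ r : ℝ, (0 : EuclideanSpace ℝ (Fin 3)) - toLp 2 ![w 0, r, w 1] = -p₀ + (-r) • e1 := by
      intro r
      rw [toLp_line_eq, hp₀]
      module
    simp_rw [hprof, hsub]
    rw [integral_const_mul]
    -- `∫ f(−r) dr = ∫ f(ρ) dρ` and the line integral of §2
    have hneg : (∫ r : ℝ, ⟪oseenKernel 1 (-p₀ + (-r) • e1) e0 e1, e1⟫) =
        ∫ ρ : ℝ, ⟪oseenKernel 1 (-p₀ + ρ • e1) e0 e1, e1⟫ :=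
      integral_neg_eq_self (fun ρ : ℝ => ⟪oseenKernel 1 (-p₀ + ρ • e1) e0 e1, e1⟫) volume
    rw [hneg, integral_inner_oseenKernel_line_self he1n hz hae one_pos, hza, hzn]
    have hd : (Module.finrank ℝ (EuclideanSpace ℝ (Fin 3)) : ℝ) = 3 := by simp
    rw [hd]
    -- the two Gaussian factors
    have hexp : Real.exp (-(w 0 ^ 2 + w 1 ^ 2) / (4 * 1)) =
        Real.exp (-(1 / 4) * w 0 ^ 2) * Real.exp (-(1 / 4) * w 1 ^ 2) := by
      rw [← Real.exp_add]; congr 1; ring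
    rw [hexp]
    by_cases hw : 0 < w 0
    · rw [Set.indicator_of_mem (show w 0 ∈ Ioi (0 : ℝ) from hw),
        Set.indicator_of_mem (show w 0 ∈ Ioi (0 : ℝ) from hw)]
      ring
    · rw [Set.indicator_of_notMem (show w 0 ∉ Ioi (0 : ℝ) from hw),
        Set.indicator_of_notMem (show w 0 ∉ Ioi (0 : ℝ) from hw)]
      ring
  simp_rw [hline]
  -- ### Step 4: the planar product integral
  have hprod := integral_euclidean_two_mul
    (fun u => (Ioi (0 : ℝ)).indicator (fun u => u * Real.exp (-(1 / 4) * u ^ 2)) u)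
    (fun v => (4 * π) ^ (-(3 : ℝ) / 2) * √(4 * π) / 2 * Real.exp (-(1 / 4) * v ^ 2))
  beta_reduce at hprod
  rw [hprod, integral_indicator_mul_exp_neg_mul_sq (by norm_num : (0 : ℝ) < 1 / 4),
    integral_const_mul, integral_gaussian]
  -- ### Step 5: arithmetic `(4π)^{-3/2} · 4π = (4π)^{-1/2}`
  have h4 : π / (1 / 4) = 4 * π := by ring
  rw [h4]
  have hs : 0 < √(4 * π) := Real.sqrt_pos.2 hpi
  have hrpow : (4 * π) ^ (-(3 : ℝ) / 2) = ((4 * π) * √(4 * π))⁻¹ := by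
    rw [show (-(3 : ℝ) / 2) = -(3 / 2 : ℝ) by ring, Real.rpow_neg hpi.le,
      show (3 / 2 : ℝ) = 1 + 1 / 2 by norm_num, Real.rpow_add hpi, Real.rpow_one, ← Real.sqrt_eq_rpow]
  rw [hrpow]
  have hsq : √(4 * π) * √(4 * π) = 4 * π := Real.mul_self_sqrt hpi.le
  field_simp
  nlinarith [hsq, hs, hpi]

/-- **`C₀(ℝ³) ≥ (4π)^{-1/2}`**: the Oseen slice constant of the tree is at least the value forced by
the shear layer (`‖N₁[𝟙{y₀>0} e₀, e₁](0)‖ ≥ (4π)^{-1/2}` against the defining bound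
`‖N₁[a,b](0)‖ ≤ C₀ · 1 · 1 · 1`). [cite: KochNadirashviliSereginSverak2009, §3 (3.5) and §4 p. 8 (arXiv:0709.3599v1)] -/
theorem inv_sqrt_four_pi_le_oseenSliceConst :
    (√(4 * π))⁻¹ ≤ oseenSliceConst (EuclideanSpace ℝ (Fin 3)) := by
  set e0 : EuclideanSpace ℝ (Fin 3) := EuclideanSpace.single (0 : Fin 3) (1 : ℝ) with he0
  set e1 : EuclideanSpace ℝ (Fin 3) := EuclideanSpace.single (1 : Fin 3) (1 : ℝ) with he1
  set a : EuclideanSpace ℝ (Fin 3) → EuclideanSpace ℝ (Fin 3) := fun y =>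
    ({y : EuclideanSpace ℝ (Fin 3) | 0 < y 0}.indicator (fun _ => (1 : ℝ)) y) • e0 with ha_def
  set b : EuclideanSpace ℝ (Fin 3) → EuclideanSpace ℝ (Fin 3) := fun _ => e1 with hb_def
  have he1n : ‖e1‖ = 1 := norm_single_one_one
  have ha1 : ∀ y, ‖a y‖ ≤ 1 := by
    intro y
    rw [ha_def]
    simp only
    rw [norm_smul, Real.norm_eq_abs, Set.indicator_apply]
    have : ‖e0‖ = 1 := by rw [he0]; simp
    rw [this, mul_one]
    split_ifs <;> simp
  have hb1 : ∀ y, ‖b y‖ ≤ 1 := fun y => by rw [hb_def]; simp only [he1n, le_refl]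
  have hbound := norm_oseenSlice_le_oseenSliceConst (σ := 1) one_pos ha1 hb1 (0 : EuclideanSpace ℝ (Fin 3))
  rw [Real.one_rpow, mul_one, mul_one, mul_one] at hbound
  have hinner : ⟪oseenSlice 1 a b 0, e1⟫ = (√(4 * π))⁻¹ := inner_oseenSlice_shearLayer_one
  have hcs : ⟪oseenSlice 1 a b 0, e1⟫ ≤ ‖oseenSlice 1 a b 0‖ := by
    have := real_inner_le_norm (oseenSlice 1 a b 0) e1
    rwa [he1n, mul_one] at this
  linarith

/-- **`C₀(ℝ³) > 0.282`** (`(4π)^{-1/2} = 0.28209…`; `π < 3.1416`): the decimal form of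
`inv_sqrt_four_pi_le_oseenSliceConst`. [cite: KochNadirashviliSereginSverak2009, §3 (3.5) and §4 p. 8 (arXiv:0709.3599v1)] -/
theorem oseenSliceConst_gt : (0.282 : ℝ) < oseenSliceConst (EuclideanSpace ℝ (Fin 3)) := by
  refine lt_of_lt_of_le ?_ inv_sqrt_four_pi_le_oseenSliceConst
  have hpi : 4 * π < 12.5664 := by have := Real.pi_lt_d4; linarith
  have hs : √(4 * π) < 3.546 := by
    rw [Real.sqrt_lt' (by norm_num)]
    nlinarith
  have hs0 : 0 < √(4 * π) := Real.sqrt_pos.2 (by positivity)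
  rw [lt_inv_comm₀ (by norm_num) hs0]
  calc √(4 * π) < 3.546 := hs
    _ ≤ (0.282 : ℝ)⁻¹ := by norm_num

end R3

end Literature.Analysis.FluidPDE

end
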